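import Mathlib
import Summits.ValiantsHypothesis.ValiantsHypothesis.Theorems.PermanentalConesPermanentalConeHardCoreLevelZero

/-!
# `PermanentalConeHard` (stmt-ValiantsHypothesis-8654), line `birth` — the orthant member is no witness

Route `PermanentalCones` of `ValiantsHypothesis`, crux `PermanentalConeHard` (H+): a nonnegative
permanental family `Q_n = per[(Y_n)_{rows<r n}; x^{(n-r n)}]` whose closed hyperbolicity cones
`{x : ∀ τ > 0, Q_n(x + τ𝟙) ≠ 0}` admit NO lifted-LMI description `{x : ∃ y, A(x,y) + B ⪰ 0}` of size
`m ≤ 2^((log₂ n + c)^c)`, for every level `c` at some `n`.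

This file records a TIGHTNESS fact (`stub_orthantNotWitness`): the trivial member `r n = 0` of the
family (no constant rows) is never a witness.  Indeed then `Q_n = per[x^{(n)}] = n! · x₁ ⋯ xₙ`
(`LevelZero.rowPermanent_eq`), its closed cone with respect to `𝟙` is the closed nonnegative orthant
`{x : ∀ j, 0 ≤ x j}` (`OrthantNotWitness.forall_eval_ne_zero_iff`), and the orthant is the diagonal
slice `{x : diagonal x ⪰ 0}` of the psd cone of size `m = n`, with no lifting variables (`p = 0`).
Since `n < 2^(log₂ n + 1) = 2^((log₂ n + 1)^1)` (`levelOne_bound_gt`), this description already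
meets the size clause at level `c = 1`, for every `n`.

References: folklore (the orthant is a spectrahedron); everything here is elementary and proved in
full.
-/

set_option linter.dupNamespace false

noncomputable section

namespace Summit.ValiantsHypothesis.ValiantsHypothesis.Theorems.PermanentalConesPermanentalConeHard

open MvPolynomial Finset
open scoped BigOperators

/-- **The level-`c = 1` size bound exceeds `n`**: `n < 2 ^ ((log₂ n + 1) ^ 1)`.  Consequently the
level-`c = 1` clause of the crux asks for psd-rank `> 2^(⌊log₂ n⌋ + 1) > n`, which (by the rank
obstruction `stub_gradientFoolingPatternLeVars` of the psd-rank toolkit `PsdRankTools`: a triangular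
fooling pattern in a gradient slack matrix of an `n`-variate form has size `≤ n`) triangular
certificates never reach: they settle level `c = 0` only. [folklore] -/
theorem levelOne_bound_gt (n : ℕ) : n < 2 ^ ((Nat.log 2 n + 1) ^ 1) := by
  rw [pow_one]
  exact Nat.lt_pow_succ_log_self Nat.one_lt_two n

namespace OrthantNotWitness

/-- **The closed cone of `c · x₁ ⋯ xₙ` (`c ≠ 0`) with respect to `𝟙` is the closed orthant**:
`(∀ τ > 0, c · ∏ⱼ (xⱼ + τ) ≠ 0) ↔ ∀ j, 0 ≤ xⱼ`.  (`→`: if `xⱼ < 0`, the shift `τ := -xⱼ > 0` kills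
the `j`-th factor; `←`: all factors are positive.) [folklore] -/
theorem forall_eval_ne_zero_iff {n : ℕ} {c : ℝ} (hc : c ≠ 0) (x : Fin n → ℝ) :
    (∀ τ : ℝ, 0 < τ → MvPolynomial.eval (fun j => x j + τ)
        (C c * ∏ i : Fin n, (X i : MvPolynomial (Fin n) ℝ)) ≠ 0) ↔ ∀ j, 0 ≤ x j := by
  constructor
  · intro h j
    by_contra hj
    refine h (-x j) (neg_pos.mpr (not_le.mp hj)) ?_
    rw [LevelZero.eval_C_mul_prod_X,
      Finset.prod_eq_zero (Finset.mem_univ j) (by rw [add_neg_cancel]), mul_zero]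
  · intro hx τ hτ
    rw [LevelZero.eval_C_mul_prod_X]
    refine mul_ne_zero hc (Finset.prod_pos fun j _ => ?_).ne'
    linarith [hx j]

/-- **The closed orthant is the diagonal slice of the psd cone**: for the size-`n` linear pencil
`A (x, y) := diagonal x` (no lifting variables, `y : Fin 0 → ℝ`) and `B := 0`,
`(∃ y, A (x, y) + B ⪰ 0) ↔ ∀ j, 0 ≤ xⱼ`. [folklore] -/
theorem exists_diagonal_posSemidef_iff {n : ℕ} (x : Fin n → ℝ) :
    (∃ y : Fin 0 → ℝ,
        ((Matrix.diagonalLinearMap (Fin n) ℝ ℝ).comp (LinearMap.fst ℝ (Fin n → ℝ) (Fin 0 → ℝ))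
            (x, y) + (0 : Matrix (Fin n) (Fin n) ℝ)).PosSemidef) ↔ ∀ j, 0 ≤ x j := by
  have happly : ∀ y : Fin 0 → ℝ,
      ((Matrix.diagonalLinearMap (Fin n) ℝ ℝ).comp (LinearMap.fst ℝ (Fin n → ℝ) (Fin 0 → ℝ)))
          (x, y) + (0 : Matrix (Fin n) (Fin n) ℝ) = Matrix.diagonal x := fun y => by
    rw [add_zero, LinearMap.comp_apply, LinearMap.fst_apply]
    rfl
  simp only [happly, Matrix.posSemidef_diagonal_iff]
  exact ⟨fun ⟨_, h⟩ => h, fun h => ⟨Fin.elim0, h⟩⟩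

end OrthantNotWitness

/-- Registered form (`stub_orthantNotWitness`): the all-variable member `r n = 0` of the permanental
family, `P = per[x^{(n)}] = n! · x₁ ⋯ xₙ`, has as closed hyperbolicity cone (w.r.t. `𝟙`) the closed
nonnegative orthant, which IS a lifted-LMI set of size `m = n ≤ 2 ^ ((log₂ n + 1) ^ 1)` — take
`p = 0`, `A (x, y) = diagonal x`, `B = 0` — so it never witnesses the crux beyond level `c = 0`.
[folklore] -/
theorem stub_orthantNotWitness : ∀ (n : ℕ) (Y : Matrix (Fin n) (Fin n) ℝ) (P : MvPolynomial (Fin n) ℝ), P = (Matrix.of fun i j : Fin n => if (i : ℕ) < 0 then MvPolynomial.C (Y i j) else MvPolynomial.X j).permanent → ∃ m ≤ 2 ^ ((Nat.log 2 n + 1) ^ 1), ∃ (p : ℕ) (A : (Fin n → ℝ) × (Fin p → ℝ) →ₗ[ℝ] Matrix (Fin m) (Fin m) ℝ) (B : Matrix (Fin m) (Fin m) ℝ), ∀ x : Fin n → ℝ, (∀ τ : ℝ, 0 < τ → MvPolynomial.eval (fun j => x j + τ) P ≠ 0) ↔ ∃ y : Fin p → ℝ, (A (x, y) + B).PosSemidef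 := by
  intro n Y P hP
  -- the member is `P = n! · x₁ ⋯ xₙ`
  have hPn : P = C ((Nat.factorial n : ℕ) : ℝ) * ∏ i : Fin n, (X i : MvPolynomial (Fin n) ℝ) := by
    rw [hP]
    exact LevelZero.rowPermanent_eq n Y
  have hfac : ((Nat.factorial n : ℕ) : ℝ) ≠ 0 := Nat.cast_ne_zero.mpr (Nat.factorial_ne_zero n)
  -- size `m := n`, no lifting variables, the diagonal pencil
  refine ⟨n, (levelOne_bound_gt n).le, 0,
    (Matrix.diagonalLinearMap (Fin n) ℝ ℝ).comp (LinearMap.fst ℝ (Fin n → ℝ) (Fin 0 → ℝ)), 0,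
    fun x => ?_⟩
  rw [hPn, OrthantNotWitness.forall_eval_ne_zero_iff hfac x,
    OrthantNotWitness.exists_diagonal_posSemidef_iff x]

end Summit.ValiantsHypothesis.ValiantsHypothesis.Theorems.PermanentalConesPermanentalConeHard

end
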